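import Literature.AnabelianGeometry.SemiGraphs.Coverticial
import Literature.AnabelianGeometry.SemiGraphs.CoveringEstrangedTransfer
import Literature.AnabelianGeometry.SemiGraphs.CoveringElevatedTransfer
import HarnessLib

/-!
# [SemiAnbd] Remark 2.4.1 along finite étale coverings: the elevated / aloof / estranged clauses of
# `remark_2_4_1_covering` — PROOFS (wrapper)

Mochizuki, *Semi-graphs of anabelioids*, Publ. RIMS **42** (2006) 221–322, §2, Remark 2.4.1, author's
manuscript p. 26 [cite: MochizukiSemiAnbd2006, Rem. 2.4.1 p.26]: "one verifies easily that if `𝒢' → 𝒢`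
is a finite étale covering, and `v'` (respectively, `e'`; `e'`; `e'`) is a(n) vertex (respectively,
edge; edge; edge) of `𝒢'` that maps to a(n) elevated vertex `v` (respectively, universally
sub-coverticial edge `e`; aloof edge `e`; estranged edge `e`) of `𝒢`, then `v'` (respectively, `e'`;
`e'`; `e'`) is itself elevated (respectively, universally sub-coverticial; aloof; estranged)."

PROOF-ONLY companion (abc-iut cell, layer L3, row W4-17 of abc-iut-L3-lead 2026-08-25T23:38:18Z;
statement owner abc-iut-L3-t1, `Coverticial.lean` rev 4, named fact
`SemiGraphOfAnabelioids.remark_2_4_1_covering`, clauses c1–c4).  No definition is introduced and no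
statement of `Coverticial.lean` is altered.  For a finite étale covering in print's sense
(`Hom.IsFiniteEtaleCoveringGlobal` = local description ∧ global clause ∧ branch-aligned ∧
vertex-aligned) we obtain `⟨A, hloc, hglob, hal, hva⟩` and apply, edge by edge / vertex by vertex,
the transfer theorems already in the tree:

* clause c3 (aloof) and c4 (estranged): abc-iut-L4-t17's (D7) core
  `SemiGraphOfAnabelioids.isAloof_of_isBranchAligned` / `isEstranged_of_isBranchAligned`
  (`CoveringEstrangedTransfer.lean`: the intersection condition of Def. 2.4 (iv) descends along the
  injective `ι := π₁(φ_{v'}^*) : Π_{v'} ↪ Π_v` through the finite-index sandwich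
  `ι(Π_{b'}) ≤ Π_b^{al}` of `CoveringBranchFrames.lean`, branch alignment supplying the frames) — only
  the LOCAL description and BRANCH ALIGNMENT are used;
* clause c1 (elevated): abc-iut-L4-t17's (D6) `SemiGraphOfAnabelioids.isElevated_of_isFiniteEtaleCoveringOf`
  (`CoveringElevatedTransfer.lean`) — only the LOCAL description is used;
* clause c2 (universally sub-coverticial) is NOT proved here ("depends on the gluing", statement
  owner's note): it needs the stability of print's finite étale coverings under composition, which the
  tree does not yet hold for `SemiGraphOfAnabelioids.Hom` (the 2-cells `φ_b` are data and no
  composition of such morphisms is defined).  We prove its purely combinatorial half — a proper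
  morphism reflects closed edges (`isClosedEdge_of_isFiniteEtaleCoveringGlobal`) — and record the
  assembly `remark_2_4_1_covering_of_universallySubCoverticial`, which reduces the named fact to
  clause c2 ALONE, stated verbatim as a hypothesis (no new `Prop` is named).

Honest framing: typed ≠ discharged — `remark_2_4_1_covering` itself stays open modulo c2; nothing
here takes a side on [IUTchIII] Cor. 3.12.
-/

namespace Literature.AnabelianGeometry.SemiGraphs

open CategoryTheory

universe v₁ u₁ u

namespace SemiGraphOfAnabelioids

variable {𝒢 𝒢' : SemiGraphOfAnabelioids.{v₁, u₁, u}}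

/-! ### Clauses c3, c4: aloof and estranged edges lift along finite étale coverings -/

/-- **[SemiAnbd] Remark 2.4.1, aloof clause (c3)**: along a finite étale covering `φ : 𝒢' → 𝒢` (in
print's sense, `Hom.IsFiniteEtaleCoveringGlobal`), an edge `e'` of `𝒢'` lying over an aloof edge of
`𝒢` is aloof.  Wrapper around abc-iut-L4-t17's `isAloof_of_isBranchAligned` (local description +
branch alignment). [cite: MochizukiSemiAnbd2006, Rem. 2.4.1 p.26] -/
theorem Hom.IsFiniteEtaleCoveringGlobal.isAloof {φ : Hom 𝒢' 𝒢} (hφ : φ.IsFiniteEtaleCoveringGlobal)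
    (e' : 𝒢'.graph.Edge) (h : 𝒢.IsAloof (φ.base.edgeMap e')) : 𝒢'.IsAloof e' := by
  obtain ⟨A, hloc, -, hal, -⟩ := hφ
  exact isAloof_of_isBranchAligned φ A hloc hal e' h

/-- **[SemiAnbd] Remark 2.4.1, estranged clause (c4)**: along a finite étale covering `φ : 𝒢' → 𝒢`, an
edge `e'` of `𝒢'` lying over an estranged edge of `𝒢` is estranged.  Wrapper around abc-iut-L4-t17's
`isEstranged_of_isBranchAligned`. [cite: MochizukiSemiAnbd2006, Rem. 2.4.1 p.26] -/
theorem Hom.IsFiniteEtaleCoveringGlobal.isEstranged {φ : Hom 𝒢' 𝒢}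
    (hφ : φ.IsFiniteEtaleCoveringGlobal) (e' : 𝒢'.graph.Edge)
    (h : 𝒢.IsEstranged (φ.base.edgeMap e')) : 𝒢'.IsEstranged e' := by
  obtain ⟨A, hloc, -, hal, -⟩ := hφ
  exact isEstranged_of_isBranchAligned φ A hloc hal e' h

/-- Totally aloof semi-graphs of anabelioids have totally aloof finite étale coverings
(Remark 2.4.1, aloof clause, for every edge). [cite: MochizukiSemiAnbd2006, Rem. 2.4.1 p.26] -/
theorem Hom.IsFiniteEtaleCoveringGlobal.isTotallyAloof {φ : Hom 𝒢' 𝒢}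
    (hφ : φ.IsFiniteEtaleCoveringGlobal) (h : 𝒢.IsTotallyAloof) : 𝒢'.IsTotallyAloof :=
  ⟨fun e' => hφ.isAloof e' (h.isAloof _)⟩

/-- Totally estranged semi-graphs of anabelioids have totally estranged finite étale coverings
(Remark 2.4.1, estranged clause, for every edge). [cite: MochizukiSemiAnbd2006, Rem. 2.4.1 p.26] -/
theorem Hom.IsFiniteEtaleCoveringGlobal.isTotallyEstranged {φ : Hom 𝒢' 𝒢}
    (hφ : φ.IsFiniteEtaleCoveringGlobal) (h : 𝒢.IsTotallyEstranged) : 𝒢'.IsTotallyEstranged :=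
  ⟨fun e' => hφ.isEstranged e' (h.isEstranged _)⟩

/-! ### Clause c1: elevated vertices lift along finite étale coverings -/

/-- **[SemiAnbd] Remark 2.4.1, elevated clause (c1)**: along a finite étale covering `φ : 𝒢' → 𝒢`, a
vertex `v'` of `𝒢'` lying over an elevated vertex of `𝒢` is elevated.  Wrapper around
abc-iut-L4-t17's `isElevated_of_isFiniteEtaleCoveringOf` (only the local description is used).
[cite: MochizukiSemiAnbd2006, Rem. 2.4.1 p.26] -/
theorem Hom.IsFiniteEtaleCoveringGlobal.isElevated {φ : Hom 𝒢' 𝒢}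
    (hφ : φ.IsFiniteEtaleCoveringGlobal) (v' : 𝒢'.graph.Vertex)
    (h : 𝒢.IsElevated (φ.base.vertexMap v')) : 𝒢'.IsElevated v' := by
  obtain ⟨A, hloc, -, -, -⟩ := hφ
  exact isElevated_of_isFiniteEtaleCoveringOf φ A hloc v' h

/-! ### Clause c2, combinatorial half: closed edges are reflected by finite étale coverings -/

/-- The underlying morphism of semi-graphs of a finite étale covering (local description) is proper
(verticial cardinalities of edges are preserved; [SemiAnbd] p. 23 "lies over some proper morphism of
semi-graphs"). [cite: MochizukiSemiAnbd2006, Def. 2.2(i) p.23] -/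
theorem Hom.IsFiniteEtaleCoveringOf.isProper {φ : Hom 𝒢' 𝒢} {A : 𝒢.BObj}
    (hφ : φ.IsFiniteEtaleCoveringOf A) : SemiGraph.IsProper φ.base :=
  hφ.1

/-- Along a finite étale covering `φ : 𝒢' → 𝒢`, an edge of `𝒢'` over a CLOSED edge of `𝒢` is closed
(the morphism of underlying semi-graphs is proper) — the combinatorial half of clause c2 of
Remark 2.4.1 (the universally sub-coverticial clause). [cite: MochizukiSemiAnbd2006, Rem. 2.4.1 p.26] -/
theorem Hom.IsFiniteEtaleCoveringGlobal.isClosedEdge {φ : Hom 𝒢' 𝒢}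
    (hφ : φ.IsFiniteEtaleCoveringGlobal) (e' : 𝒢'.graph.Edge)
    (h : 𝒢.graph.IsClosedEdge (φ.base.edgeMap e')) : 𝒢'.graph.IsClosedEdge e' := by
  obtain ⟨A, hloc, -, -, -⟩ := hφ
  have hp : 𝒢.graph.vertCard (φ.base.edgeMap e') = 𝒢'.graph.vertCard e' := hloc.isProper e'
  unfold SemiGraph.IsClosedEdge at h ⊢
  rw [← hp]
  exact h

/-! ### Assembly: `remark_2_4_1_covering` reduced to its universally-sub-coverticial clause -/

/-- **[SemiAnbd] Remark 2.4.1 (second sentence) along finite étale coverings — ASSEMBLY modulo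
clause c2**: the named fact `remark_2_4_1_covering` of `Coverticial.lean` follows from its
universally-sub-coverticial clause alone (stated verbatim as the hypothesis `h2`; it depends on the
gluing / the composition of finite étale coverings and is not proved in this file), the elevated /
aloof / estranged clauses being the theorems above.  Conditional discharge: the named fact stays
OPEN modulo c2. [cite: MochizukiSemiAnbd2006, Rem. 2.4.1 p.26] -/
theorem remark_2_4_1_covering_of_universallySubCoverticial
    (h2 : ∀ (𝒢 𝒢' : SemiGraphOfAnabelioids.{v₁, u₁, u}) (φ : Hom 𝒢' 𝒢),
      φ.IsFiniteEtaleCoveringGlobal →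
        ∀ e', 𝒢.IsUniversallySubCoverticial (φ.base.edgeMap e') →
          𝒢'.IsUniversallySubCoverticial e') :
    Literature.AnabelianGeometry.SemiGraphs.SemiGraphOfAnabelioids.remark_2_4_1_covering.{v₁, u₁, u} :=
  fun 𝒢 𝒢' φ hφ =>
    ⟨fun v' hv => hφ.isElevated v' hv, fun e' he => h2 𝒢 𝒢' φ hφ e' he,
      fun e' he => hφ.isAloof e' he, fun e' he => hφ.isEstranged e' he⟩

end SemiGraphOfAnabelioids

end Literature.AnabelianGeometry.SemiGraphs
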